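import Mathlib
import Summits.MatrixMultiplication.MatrixMultiplication.Theorems.HyperoctahedralThreshold.Negative.HostedTPPSATTransfer
import Summits.MatrixMultiplication.MatrixMultiplication.Theorems.HyperoctahedralThreshold.Negative.Census6Data

/-!
# `P_hyp(6) ≤ 2048` modulo the six class UNSAT facts (assembly)

Every triple `μ` of fixed-point-free involutions of `Fin 6` is, up to simultaneous conjugation and a
permutation of the three colours, one of the 8 class representatives `mus6 k` (classification table
`tbl6`, verified here by evaluation); the UNSAT hypotheses give `≤ 2048` for classes 2–7 (`volume_le_of_unsat_centralizer`), pair packing for classes 0–1; `hosted_bound_conj` / `hosted_bound_perm` transport the bound.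
-/

namespace Summit.MatrixMultiplication.MatrixMultiplication.Theorems.HyperoctahedralThreshold.Negative

set_option linter.dupNamespace false

open Literature.Computability.Complexity Literature.Combinatorics.Additive

/-- **Pair-packing-only volume bound**: `(|X 0||X 1||X 2|)² ≤ pc₀₁ · pc₁₂ · pc₂₀` for a hosted TPP triple
(`HostData.card_mul_card_le_pairCount` for the three cyclic pairs). [cite: CohnUmans2003, Lemma 3.1] -/
theorem HostData.volume_sq_le_pairCounts {G : Type*} [Group G] [DecidableEq G] {N : ℕ} (D : HostData G N)
    (X : Fin 3 → Finset G) (hX : ∀ i, ∀ x ∈ X i, ∃ a, D.E i a = x)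
    (htpp : TripleProductProperty (X 0) (X 1) (X 2)) :
    ((X 0).card * (X 1).card * (X 2).card) ^ 2 ≤ D.pairCount 0 1 * D.pairCount 1 2 * D.pairCount 2 0 := by
  classical
  by_cases hne : ∀ i, (X i).Nonempty
  · have p01 := D.card_mul_card_le_pairCount htpp (hne 2) (hX 0) (hX 1)
    have p12 := D.card_mul_card_le_pairCount (HostData.tpp_rotate htpp) (hne 0) (hX 1) (hX 2)
    have p20 := D.card_mul_card_le_pairCount (HostData.tpp_rotate (HostData.tpp_rotate htpp)) (hne 1) (hX 2) (hX 0)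
    calc ((X 0).card * (X 1).card * (X 2).card) ^ 2
        = ((X 0).card * (X 1).card) * ((X 1).card * (X 2).card) * ((X 2).card * (X 0).card) := by ring
      _ ≤ D.pairCount 0 1 * D.pairCount 1 2 * D.pairCount 2 0 :=
        Nat.mul_le_mul (Nat.mul_le_mul p01 p12) p20
  · push Not at hne
    obtain ⟨i, hi⟩ := hne
    have h0 : (X i).card = 0 := Finset.card_eq_zero.2 hi
    have hprod : (X 0).card * (X 1).card * (X 2).card = ∏ j : Fin 3, (X j).card :=
      (Fin.prod_univ_three (fun j => (X j).card)).symm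
    rw [hprod, Finset.prod_eq_zero (Finset.mem_univ i) h0]
    simp


/-- The pair counts of class 0 (by evaluation). [folklore] -/
theorem D6c0_pairCounts : D6c0.pairCount 0 1 * D6c0.pairCount 1 2 * D6c0.pairCount 2 0 = 110592 := by
  native_decide

/-- **Class 0 is below `2048` by pair packing alone** (`volume² ≤ 110592 < 2049²`).
[cite: CohnUmans2003, Lemma 3.1] -/
theorem D6c0_volume_le (X : Fin 3 → Finset (Equiv.Perm (Fin 6)))
    (hX : ∀ i, ∀ σ ∈ X i, σ * D6c0_mu i = D6c0_mu i * σ)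
    (h : TripleProductProperty (X 0) (X 1) (X 2)) :
    (X 0).card * (X 1).card * (X 2).card ≤ 2048 := by
  have hsq := D6c0.volume_sq_le_pairCounts X (fun i σ hσ => (D6c0_host i σ).1 (hX i σ hσ)) h
  rw [D6c0_pairCounts] at hsq
  have hlt : ((X 0).card * (X 1).card * (X 2).card) ^ 2 < 2049 ^ 2 := lt_of_le_of_lt hsq (by norm_num)
  have := lt_of_pow_lt_pow_left₀ 2 (by positivity) hlt
  omega

/-- The pair counts of class 1 (by evaluation). [folklore] -/
theorem D6c1_pairCounts : D6c1.pairCount 0 1 * D6c1.pairCount 1 2 * D6c1.pairCount 2 0 = 3981312 := by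
  native_decide

/-- **Class 1 is below `2048` by pair packing alone** (`volume² ≤ 3981312 < 2049²`).
[cite: CohnUmans2003, Lemma 3.1] -/
theorem D6c1_volume_le (X : Fin 3 → Finset (Equiv.Perm (Fin 6)))
    (hX : ∀ i, ∀ σ ∈ X i, σ * D6c1_mu i = D6c1_mu i * σ)
    (h : TripleProductProperty (X 0) (X 1) (X 2)) :
    (X 0).card * (X 1).card * (X 2).card ≤ 2048 := by
  have hsq := D6c1.volume_sq_le_pairCounts X (fun i σ hσ => (D6c1_host i σ).1 (hX i σ hσ)) h
  rw [D6c1_pairCounts] at hsq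
  have hlt : ((X 0).card * (X 1).card * (X 2).card) ^ 2 < 2049 ^ 2 := lt_of_le_of_lt hsq (by norm_num)
  have := lt_of_pow_lt_pow_left₀ 2 (by positivity) hlt
  omega

/-- Each class representative satisfies the bound `2048`, GIVEN the UNSAT facts for classes 2–7
(classes 0, 1 by pair packing alone). [folklore] -/
theorem class6_bound_of_unsat
    (h2 : ¬ (D6c2.certCNF D6c2.pairBounds 2048).Satisfiable)
    (h3 : ¬ (D6c3.certCNF D6c3.pairBounds 2048).Satisfiable)
    (h4 : ¬ (D6c4.certCNF D6c4.pairBounds 2048).Satisfiable)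
    (h5 : ¬ (D6c5.certCNF D6c5.pairBounds 2048).Satisfiable)
    (h6 : ¬ (D6c6.certCNF D6c6.pairBounds 2048).Satisfiable)
    (h7 : ¬ (D6c7.certCNF D6c7.pairBounds 2048).Satisfiable)
    (k : Fin 8) : ∀ X : Fin 3 → Finset (Equiv.Perm (Fin 6)),
    (∀ i, ∀ σ ∈ X i, σ * mus6 k i = mus6 k i * σ) → TripleProductProperty (X 0) (X 1) (X 2) →
      (X 0).card * (X 1).card * (X 2).card ≤ 2048 := by
  fin_cases k
  · intro X hX h; exact D6c0_volume_le X hX h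
  · intro X hX h; exact D6c1_volume_le X hX h
  · intro X hX h; exact D6c2.volume_le_of_unsat_centralizer D6c2_mu D6c2_host D6c2_inj D6c2_one h2 X hX h
  · intro X hX h; exact D6c3.volume_le_of_unsat_centralizer D6c3_mu D6c3_host D6c3_inj D6c3_one h3 X hX h
  · intro X hX h; exact D6c4.volume_le_of_unsat_centralizer D6c4_mu D6c4_host D6c4_inj D6c4_one h4 X hX h
  · intro X hX h; exact D6c5.volume_le_of_unsat_centralizer D6c5_mu D6c5_host D6c5_inj D6c5_one h5 X hX h
  · intro X hX h; exact D6c6.volume_le_of_unsat_centralizer D6c6_mu D6c6_host D6c6_inj D6c6_one h6 X hX h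
  · intro X hX h; exact D6c7.volume_le_of_unsat_centralizer D6c7_mu D6c7_host D6c7_inj D6c7_one h7 X hX h

/-- **`P_hyp(6) ≤ 2048` modulo six UNSAT facts.**  If the certificate CNFs of host classes 2–7 at `V = 2048`
are unsatisfiable (each has an LRAT refutation of 70 MB scale, verified outside Lean by an independent checker —
too large to travel as a Lean term, see the seat's needs-human note), then every TPP triple inside the centralisers
of three fixed-point-free involutions of `Fin 6` has volume `≤ 2048` (attained: `hyp6_witness`).  Everything else —
encoder semantics, pair packing for classes 0–1, the classification of all 3375 matching triples — is proved here /
in the imported files. [cite: CohnUmans2003, Def. 2.1] -/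
theorem hyp6_volume_le_of_unsat
    (h2 : ¬ (D6c2.certCNF D6c2.pairBounds 2048).Satisfiable)
    (h3 : ¬ (D6c3.certCNF D6c3.pairBounds 2048).Satisfiable)
    (h4 : ¬ (D6c4.certCNF D6c4.pairBounds 2048).Satisfiable)
    (h5 : ¬ (D6c5.certCNF D6c5.pairBounds 2048).Satisfiable)
    (h6 : ¬ (D6c6.certCNF D6c6.pairBounds 2048).Satisfiable)
    (h7 : ¬ (D6c7.certCNF D6c7.pairBounds 2048).Satisfiable)
    (μ : Fin 3 → Equiv.Perm (Fin 6)) (hμ : ∀ i, μ i * μ i = 1 ∧ ∀ x, μ i x ≠ x)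
    (X : Fin 3 → Finset (Equiv.Perm (Fin 6))) (hX : ∀ i, ∀ σ ∈ X i, σ * μ i = μ i * σ)
    (htpp : TripleProductProperty (X 0) (X 1) (X 2)) :
    (X 0).card * (X 1).card * (X 2).card ≤ 2048 := by
  obtain ⟨a, ha⟩ := exists_M6f_eq (μ 0) (hμ 0)
  obtain ⟨b, hb⟩ := exists_M6f_eq (μ 1) (hμ 1)
  obtain ⟨c, hc⟩ := exists_M6f_eq (μ 2) (hμ 2)
  set ν : Fin 3 → Equiv.Perm (Fin 6) := ![M6f a, M6f b, M6f c] with hν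
  have hμν : μ = ν := by
    funext i; fin_cases i
    · simpa [hν] using ha.symm
    · simpa [hν] using hb.symm
    · simpa [hν] using hc.symm
  subst hμν
  have hspec := tbl6f_spec a b c
  set k := (tbl6f a b c).1
  set g := (tbl6f a b c).2.1
  set π := (tbl6f a b c).2.2
  have hb1 := hosted_bound_conj (class6_bound_of_unsat h2 h3 h4 h5 h6 h7 k) g
  have hb2 : ∀ Y : Fin 3 → Finset (Equiv.Perm (Fin 6)),
      (∀ i, ∀ σ ∈ Y i, σ * ν (π i) = ν (π i) * σ) → TripleProductProperty (Y 0) (Y 1) (Y 2) →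
        (Y 0).card * (Y 1).card * (Y 2).card ≤ 2048 := fun Y hY h =>
    hb1 Y (fun i σ hσ => by rw [← hspec i]; exact hY i σ hσ) h
  have hb3 := hosted_bound_perm (μ := fun i => ν (π i)) hb2 π.symm
  exact hb3 X (fun i σ hσ => by simpa using hX i σ hσ) htpp

end Summit.MatrixMultiplication.MatrixMultiplication.Theorems.HyperoctahedralThreshold.Negative
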